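import Literature.IUT.HodgeTheaters.InitialThetaDataTorsionMonodromyProofs
import HarnessLib

/-!
# [IUTchI] Def 6.1 (ii)(iii) / Ex 6.3 (i): the LOCAL ARROW LAW (L1) of abc-iut-L5-t4's `LocalArrowLaw`, DERIVED by the
# BOREL ARGUMENT from the `l`-torsion monodromy datum (proof-only; post-freeze additive D13 piece, not a cone member)

S. Mochizuki, *Inter-universal Teichmüller theory I*, kurims manuscript (May 2020), §6 Def 6.1 (v) p. 158 l. 9–21 «the
outer homomorphism `Aut(𝒟^{⊚±}) → GL₂(𝔽_l)/{±1}` arising from the `l`-torsion points of `E_F` [i.e., from the Galois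
action on `Δ_X^{ab} ⊗ 𝔽_l`] … contains a Borel subgroup … corresponding to the rank one quotient of `Δ_X^{ab} ⊗ 𝔽_l`
that gives rise to the covering `X̲_K → X_K`», Ex 6.3 (i) p. 161 («`φ^{Θell}_{v̲_t}` … obtained by post-composing
`φ^{Θell}_0` with the poly-action of `t` on `𝒟^{⊚±}`»), Cor 1.2 proof p. 39 («`Π_{X̲} = Π_{X→} · H`,
`H := Ker(Δ_X ↠ Δ_X^{ab} ⊗ ℤ/l)`») [cite: Mochizuki2012, Def 6.1(v) p.158; Ex 6.3(i) p.161; Cor 1.2 p.39] (D-0012 claim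
key; series DISPUTED — this file is finite group theory and linear algebra mod `l` over abc-iut-L5-t2's REAL
`InitialThetaData`, abc-iut-L5-t8's datum `InitialThetaData.TorsionMonodromy` and abc-iut-L5-t1's CONSTRUCTION
`PuncturedEllipticData.piXarrow`; nothing of the series is asserted; no side is taken on [IUTchIII] Cor. 3.12).

WHAT (abc-iut-L5-lead gen 6 RULINGS #57 (3)(R2), #60 (1); GAP-LEDGER G-L5t4g4-1).  abc-iut-L5-t4's interface law
`InitialThetaData.LocalArrowLaw CG hS H` (`PiAvatarLocalLabels.lean`, p440701) of a local object `𝒟_v̲ = ℬ(H)⁰` has the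
field **(L1) `mem_normalizer_of_conj_le : ∀ d : Π_{C_F}, (∀ x ∈ H, d⁻¹ x d ∈ Π_{X̲_K}) → d ∈ N_{Π_{C_F}}(Π_{X̲_K})`**
(«morphisms `𝒟_v̲ → 𝒟^{⊚±}` are `Aut(𝒟^{⊚±})`-translates of `φ^{Θell}_{•,v̲}`»), recorded there as «NOT derivable from the
typed §1/§3 data alone».  Here it is PROVED for EVERY `H ⊇ embK(jKer)` — in particular for the local groups
`Π_v̲ = Π_{X̲→_K} ∩ augGF⁻¹(G_v̲)` (`localArrowLaw_L1_local`) — from THREE named inputs: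
* `M : D.TorsionMonodromy` (abc-iut-L5-t8, p433356: cocycle `τ : Π_{X_F} → E_F[l](F̄)`, line `𝔽_l·gen`,
  «`Π_{X̲_K} = {k ∈ Π_{X_K} | τ k ∈ ℤ·gen}`»; companion p433603: `tau_conj`, `conj_mem_PiXK_iff`);
* `hA : D.geom.pe.ArrowCoveringClaims` (printed claims of §1 pp. 37–38; only `inertia_ε1_sup : I_{ε′} ⊔ jKer = Δ_X̲`
  is used; already a binder of the layer-5 certificate);
* `hI : ∀ k ∈ I_{ε′}, τ(embK k) = 0` — an EXPLICIT NAMED BINDER labelled (RULINGS #60 (1)(i)) «(rel)-type classical law: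
  the cusp inertia of `X` dies in `Δ_X^{ab} ⊗ 𝔽_l = E[l]` (`[l] : E → E` étale over the origin; `Δ_X ≅ F̂₂` with the
  puncture class a commutator)»; print: [EtTh] Def 2.1 «`D_x → Q` is trivial», which `TorsionMonodromy.mem_PiXund_iff`
  records only modulo the line.  It would follow from the (rel)-type law «`I_x ⊆ closure ⁅Δ_X, Δ_X⁆`» (cf. abc-iut-L5-t1's
  (rel) binder in `ArrowCoveringClaims.not_inertia_ε0_le_piXarrow_of_orientedInertia`, p438104; cusp-law file
  `ModLCuspLaws` announced — cite its field once landed) PLUS continuity of `τ`, which the datum does not record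
  either; so `hI` stays primitive (no new `Prop` def, D-0067 (5)); interface gap = GAP-LEDGER G-L5d5g6-1.

THE BOREL ARGUMENT: (A) `mem_normalizer_PiXund_of_stabilizes_line` — `d ∈ Π_{X_F}` with `σ_{d^{±1}}(𝔽_l·gen) ⊆ 𝔽_l·gen`
normalises `Π_{X̲_K}` (conjugation acts on `Π_{X_K}/Π_{X̲_K} ↪ E[l]/𝔽_l·gen` through `σ_d`); (B)
`exists_not_mem_PiX_mem_normalizer_PiXund` — some `c ∈ Π_{C̲_K} ∖ Π_{X_F}` normalises `Π_{X̲_K}` (index `2` twice);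
(C) `exists_mem_jKer_tau_eq_smul_gen` — THE CRUX «`τ(Δ_{X̲→}) ≠ 0`»: `τ` is additive on `Π_{X_K}`; were it zero on
`embK(jKer)` and on `embK(I_{ε′})` it would vanish on `embK(Δ_X̲) ∋` a preimage of `gen ≠ 0`; (D)
`localArrowLaw_L1_of_torsionMonodromy` — `d⁻¹ (embK k₀) d ∈ Π_{X̲_K}` gives `σ_{d⁻¹}(a·gen) ∈ ℤ·gen` with `l ∤ a`, so
`σ_{d^{∓1}}` stabilise the line and (A) applies (`d ∉ Π_{X_F}` reduced by (B)).  `ImageContainsSL2` is NOT used.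
EFFECT: the (L1) field of `Λ : D.LocalArrowLaw CG hS Π_v̲` (consumed by `PiAvatarLocalOvergroupUnd`) is a THEOREM from
`{M, hA, hI}`; (L2) `sign` is NOT treated.  Proof-only (0 defs, no instance, no notation); axioms standard.  HONEST
FRAMING: `M` is an interface DATUM (NV-witnessed at abc-iut-L5-t8's semidirect model, not constructed for the genuine
curve), `hA`/`hI` are assumption labels; typed ≠ inhabited ≠ discharged; nothing here bears on [IUTchIII] Cor. 3.12.
-/

noncomputable section

namespace Literature.IUT.HodgeTheaters

open scoped WeierstrassCurve.Affine Classical Pointwise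

universe u v w

variable {F : Type u} {K : Type v} {Fbar : Type w} [Field F] [NumberField F] [Field K] [NumberField K]
  [Algebra F K] [Field Fbar] [Algebra F Fbar] [Algebra K Fbar]
  {E : WeierstrassCurve F} [E.IsElliptic] {l : ℕ} {Pb : BadPlacePredicates K}

section Plumbing
variable (E)

omit [NumberField F] [E.IsElliptic] in
/-- `1 ∈ G_F` acts trivially on `E_F(F̄)`. [folklore] -/
private theorem l1_galoisAct_one (P : GeomPoints Fbar E) : galoisAct E (1 : Fbar ≃ₐ[F] Fbar) P = P := by
  cases P <;> rfl

omit [NumberField F] [E.IsElliptic] in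
/-- `(στ)·P = σ·(τ·P)`. [folklore] -/
private theorem l1_galoisAct_mul (σ τ : Fbar ≃ₐ[F] Fbar) (P : GeomPoints Fbar E) :
    galoisAct E (σ * τ) P = galoisAct E σ (galoisAct E τ P) := by
  cases P <;> rfl

omit [NumberField F] [E.IsElliptic] in
/-- `σ⁻¹·(σ·P) = P`. [folklore] -/
private theorem l1_galoisAct_inv_apply (σ : Fbar ≃ₐ[F] Fbar) (P : GeomPoints Fbar E) :
    galoisAct E σ⁻¹ (galoisAct E σ P) = P := by
  rw [← l1_galoisAct_mul, inv_mul_cancel, l1_galoisAct_one]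

omit [NumberField F] [E.IsElliptic] in
/-- `x • P = y • P` for an `n`-torsion point `P` when `n ∣ x - y`. [folklore] -/
private theorem l1_zsmul_eq_zsmul_of_dvd_sub {n : ℤ} {P : GeomPoints Fbar E} (hP : n • P = 0) {x y : ℤ}
    (h : n ∣ x - y) : x • P = y • P := by
  obtain ⟨k, hk⟩ := h
  rw [← sub_eq_zero, sub_eq_add_neg, ← sub_zsmul, hk, mul_zsmul', hP, zsmul_zero]

omit [NumberField F] [E.IsElliptic] in
/-- `x • P = 0` for an `n`-torsion point `P` when `n ∣ x`. [folklore] -/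
private theorem l1_zsmul_eq_zero_of_dvd {n : ℤ} {P : GeomPoints Fbar E} (hP : n • P = 0) {x : ℤ} (h : n ∣ x) :
    x • P = 0 := by
  rw [l1_zsmul_eq_zsmul_of_dvd_sub E hP (y := 0) (by simpa using h), zero_zsmul]

omit [NumberField F] [E.IsElliptic] in
/-- A residue prime to the prime `l` is invertible mod `l` (on `ℤ`-lifts: `l ∣ a·d − 1`). [folklore] -/
private theorem l1_exists_mul_sub_one_dvd_of_not_dvd {l : ℕ} (hl : l.Prime) {a : ℤ} (ha : ¬ (l : ℤ) ∣ a) :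
    ∃ d : ℤ, (l : ℤ) ∣ a * d - 1 := by
  haveI : Fact l.Prime := ⟨hl⟩
  have ha' : (a : ZMod l) ≠ 0 := by rwa [Ne, ZMod.intCast_zmod_eq_zero_iff_dvd]
  refine ⟨(((a : ZMod l)⁻¹).val : ℤ), ?_⟩
  rw [← ZMod.intCast_zmod_eq_zero_iff_dvd]
  push_cast
  rw [ZMod.natCast_zmod_val, mul_inv_cancel₀ ha', sub_self]

omit [NumberField F] [E.IsElliptic] in
/-- A point of PRIME order `l`: `a • P = 0` forces `l ∣ a`. [folklore] -/
private theorem l1_dvd_of_zsmul_eq_zero {l : ℕ} (hl : l.Prime) {P : GeomPoints Fbar E} (hP : (l : ℤ) • P = 0)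
    (hP0 : P ≠ 0) {a : ℤ} (ha : a • P = 0) : (l : ℤ) ∣ a := by
  by_contra hnd
  obtain ⟨a', ha'⟩ := l1_exists_mul_sub_one_dvd_of_not_dvd hl hnd
  apply hP0
  calc P = (1 : ℤ) • P := (one_zsmul P).symm
    _ = (a' * a) • P := l1_zsmul_eq_zsmul_of_dvd_sub E hP
        (by rw [show (1 : ℤ) - a' * a = -(a * a' - 1) by ring]; exact dvd_neg.mpr ha')
    _ = a' • (a • P) := mul_zsmul _ _ _
    _ = 0 := by rw [ha, zsmul_zero]

omit [NumberField F] [E.IsElliptic] in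
/-- **One nonzero vector of an `𝔽_l`-line suffices**: an additive map of `E_F(F̄)` carrying some `a • P` with `l ∤ a`
(`P` an `l`-torsion point, `l` prime) into the line `ℤ • P` carries the whole line `ℤ • P` into itself. [folklore] -/
private theorem l1_line_stable_of_apply_smul {l : ℕ} (hl : l.Prime) (f : GeomPoints Fbar E →+ GeomPoints Fbar E)
    {P : GeomPoints Fbar E} (hP : (l : ℤ) • P = 0) {a b : ℤ} (ha : ¬ (l : ℤ) ∣ a) (hab : f (a • P) = b • P)
    (c : ℤ) : ∃ e : ℤ, f (c • P) = e • P := by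
  obtain ⟨a', ha'⟩ := l1_exists_mul_sub_one_dvd_of_not_dvd hl ha
  have hPa : P = a' • (a • P) := by
    calc P = (1 : ℤ) • P := (one_zsmul P).symm
      _ = (a' * a) • P := l1_zsmul_eq_zsmul_of_dvd_sub E hP
          (by rw [show (1 : ℤ) - a' * a = -(a * a' - 1) by ring]; exact dvd_neg.mpr ha')
      _ = a' • (a • P) := mul_zsmul _ _ _
  refine ⟨c * (a' * b), ?_⟩
  conv_lhs => rw [hPa]
  rw [← mul_zsmul, map_zsmul, hab, ← mul_zsmul]
  congr 1
  ring

end Plumbing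

namespace InitialThetaData

variable {D : InitialThetaData F K Fbar E l Pb}

namespace TorsionMonodromy

variable (M : D.TorsionMonodromy)

include M in
/-- **(A) An element `d ∈ Π_{X_F}` whose Galois image `σ_d` and its inverse stabilise the line `𝔽_l·gen ⊆ E_F[l]`
NORMALISES `Π_{X̲_K}`**: conjugation by `d` acts on `Π_{X_K} ⊇ Π_{X̲_K}` through `σ_d` on `τ`-values (`tau_conj`), and
`Π_{X̲_K} = {k ∈ Π_{X_K} | τ k ∈ ℤ·gen}` (`mem_PiXund_iff`) — «the Borel subgroup corresponding to the rank one quotient of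
`Δ_X^{ab} ⊗ 𝔽_l` that gives rise to the covering `X̲_K → X_K`». ([IUTchI] Def 6.1 (v) p.158) [claim: Mochizuki2012, status: disputed] -/
theorem mem_normalizer_PiXund_of_stabilizes_line {d : D.PiC} (hd : d ∈ D.geom.PiX)
    (h₁ : ∀ c : ℤ, ∃ e : ℤ, galoisAct E (D.augGF d) (c • M.gen) = e • M.gen)
    (h₂ : ∀ c : ℤ, ∃ e : ℤ, galoisAct E (D.augGF d⁻¹) (c • M.gen) = e • M.gen) :
    d ∈ Subgroup.normalizer ((D.PiXund : Subgroup D.PiC) : Set D.PiC) := by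
  rw [Subgroup.mem_normalizer_iff]
  intro x
  constructor
  · intro hx
    have hxK : x ∈ D.PiXK := D.PiXund_le_PiXK hx
    obtain ⟨a, ha⟩ := (M.mem_PiXund_iff x hxK).mp hx
    obtain ⟨e, he⟩ := h₁ a
    have hconjK : d * x * d⁻¹ ∈ D.PiXK := (conj_mem_PiXK_iff hd x).mpr hxK
    refine (M.mem_PiXund_iff _ hconjK).mpr ⟨e, ?_⟩
    rw [M.tau_conj hd hxK, ha, he]
  · intro hy
    have hyK : d * x * d⁻¹ ∈ D.PiXK := D.PiXund_le_PiXK hy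
    have hxK : x ∈ D.PiXK := (conj_mem_PiXK_iff hd x).mp hyK
    obtain ⟨a, ha⟩ := (M.mem_PiXund_iff _ hyK).mp hy
    obtain ⟨e, he⟩ := h₂ a
    refine (M.mem_PiXund_iff x hxK).mpr ⟨e, ?_⟩
    have hx : x = d⁻¹ * (d * x * d⁻¹) * d⁻¹⁻¹ := by group
    rw [hx, M.tau_conj (inv_mem hd) hyK, ha, he]

/-- **(B) There is `c ∈ Π_{C_F} ∖ Π_{X_F}` normalising `Π_{X̲_K}`**: the image of any `c′ ∈ Π_{C̲_K} ∖ Π_{X_K}` (t2's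
`ThetaGeometry.not_PiCbar_le_PiX`: «`C̲_K` is not a covering of `X_K`»), which normalises `Π_{X̲_K} = Π_{X_K} ∩ Π_{C̲_K}`
because `[Π_{C̲_K} : Π_{X̲_K}] = 2` (`PiXbar_relIndex_PiCbar`: «`X̲_K → C̲_K` is the quotient by the inversion»).
([IUTchI] Def 3.1 (d) p.62) [claim: Mochizuki2012, status: disputed] -/
theorem exists_not_mem_PiX_mem_normalizer_PiXund (D : InitialThetaData F K Fbar E l Pb) :
    ∃ c : D.PiC, c ∉ D.geom.PiX ∧ c ∈ Subgroup.normalizer ((D.PiXund : Subgroup D.PiC) : Set D.PiC) := by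
  obtain ⟨c', hc'C, hc'X⟩ := Set.not_subset.mp D.geom.not_PiCbar_le_PiX
  haveI hN : (D.geom.pe.PiXbar.subgroupOf D.geom.pe.PiCbar).Normal :=
    Subgroup.normal_of_index_eq_two D.geom.PiXbar_relIndex_PiCbar
  refine ⟨D.geom.embK c', ?_, ?_⟩
  · intro hc
    have hmem : D.geom.embK c' ∈ D.geom.pe.PiX.map D.geom.embK := by
      rw [D.geom.embK_PiX]
      exact ⟨hc, ⟨c', rfl⟩⟩
    obtain ⟨y, hy, hyc⟩ := hmem
    exact hc'X (D.geom.embK_injective hyc ▸ hy)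
  · rw [Subgroup.mem_normalizer_iff]
    -- conjugation by `c′ ∈ Π_{C̲_K}` preserves `Π_X̲ = Π_X ∩ Π_C̲` (normal of index 2 in `Π_C̲`)
    have hconj : ∀ (t : D.geom.pe.PiC), t ∈ D.geom.pe.PiCbar → ∀ y ∈ D.geom.pe.PiXbar,
        t * y * t⁻¹ ∈ D.geom.pe.PiXbar := by
      intro t ht y hy
      have hyC : y ∈ D.geom.pe.PiCbar := hy.2
      have h := hN.conj_mem ⟨y, hyC⟩ (Subgroup.mem_subgroupOf.mpr hy) ⟨t, ht⟩
      exact Subgroup.mem_subgroupOf.mp h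
    intro g
    constructor
    · rintro ⟨y, hy, rfl⟩
      refine ⟨c' * y * c'⁻¹, hconj c' hc'C y hy, ?_⟩
      rw [map_mul, map_mul, map_inv]
    · rintro ⟨z, hz, hzg⟩
      refine ⟨c'⁻¹ * z * c'⁻¹⁻¹, hconj c'⁻¹ (inv_mem hc'C) z hz, ?_⟩
      simp only [map_mul, map_inv, hzg]
      group

/-- `Δ_C ≤ Π_{C_K}` at the `F`-level: the geometric fundamental group lies over `1 ∈ G_K`.
([IUTchI] Def 3.1 (d) p.62) [claim: Mochizuki2012, status: disputed] -/
theorem DeltaC_le_PiCK (D : InitialThetaData F K Fbar E l Pb) : D.DeltaC ≤ D.PiCK := by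
  intro k hk
  rw [D.PiCK_eq_comap_augGF, Subgroup.mem_comap]
  have hk1 : D.geom.extF.aug k = 1 := hk
  have : D.augGF k = 1 := by
    change D.geom.galIso (D.geom.extF.aug k) = 1
    rw [hk1, map_one]
  rw [this]
  exact one_mem _

/-- An element of `Π_{C_K} = embK(Π_{C_K})` lying in `Δ_C` comes from `Δ_{C_K}` (t2's `aug_compat`).
([IUTchI] Def 3.1 (d) p.62) [claim: Mochizuki2012, status: disputed] -/
theorem mem_pe_DeltaC_of_embK_mem_DeltaC (D : InitialThetaData F K Fbar E l Pb) {y : D.geom.pe.PiC}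
    (hy : D.geom.embK y ∈ D.DeltaC) : y ∈ D.geom.pe.DeltaC := by
  have h1 : D.geom.extF.aug (D.geom.embK y) = 1 := hy
  have h2 := D.geom.aug_compat y
  rw [h1, map_one] at h2
  have h3 : (D.geom.galKIso (D.geom.pe.E.aug y) : galoisSubgroupOf F K Fbar) = 1 :=
    Subtype.ext h2.symm
  have h4 : D.geom.pe.E.aug y = 1 := by
    have := congrArg D.geom.galKIso.symm h3
    rwa [MulEquiv.symm_apply_apply, map_one] at this
  exact h4

/-- `embK(Δ_{C_K}) ≤ Δ_C`. ([IUTchI] Def 3.1 (d) p.62) [claim: Mochizuki2012, status: disputed] -/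
theorem embK_mem_DeltaC_of_mem_pe_DeltaC (D : InitialThetaData F K Fbar E l Pb) {y : D.geom.pe.PiC}
    (hy : y ∈ D.geom.pe.DeltaC) : D.geom.embK y ∈ D.DeltaC := by
  have h1 : D.geom.pe.E.aug y = 1 := hy
  have h2 := D.geom.aug_compat y
  rw [h1, map_one, Subgroup.coe_one] at h2
  change D.geom.extF.aug (D.geom.embK y) = 1
  have := congrArg D.geom.galIso.symm h2
  rwa [MulEquiv.symm_apply_apply, map_one] at this

/-- `embK(Π_X̲) ≤ Π_{X̲_K}` (definitional) and hence `embK(jKer) ≤ embK(Δ_X̲) ≤ Π_{X̲_K}` under the printed claim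
`I_{ε′} ⊔ jKer = Δ_X̲`. ([IUTchI] §1 p.38) [claim: Mochizuki2012, status: disputed] -/
theorem map_jKer_le_PiXund (hA : D.geom.pe.ArrowCoveringClaims) : D.geom.pe.jKer.map D.geom.embK ≤ D.PiXund := by
  refine Subgroup.map_mono ?_
  calc D.geom.pe.jKer ≤ D.geom.pe.inertia D.geom.pe.ε1 ⊔ D.geom.pe.jKer := le_sup_right
    _ = D.geom.pe.DeltaXbar := hA.inertia_ε1_sup
    _ ≤ D.geom.pe.PiXbar := inf_le_left

include M in
/-- **(C) THE CRUX «`τ(Δ_{X̲→}) ≠ 0`»** (print: «`Π_X̲ = Π_{X→} · H`, `H := Ker(Δ_X ↠ Δ_X^{ab} ⊗ ℤ/l)`», Cor 1.2 proof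
p.39): GIVEN the printed claim `I_{ε′} ⊔ jKer = Δ_X̲` and the named input `hI : τ(embK I_{ε′}) = 0` («(rel)-type classical
law: the cusp inertia of `X` dies in `Δ_X^{ab} ⊗ 𝔽_l = E[l]`», GAP G-L5d5g6-1), some `k₀ ∈ jKer = Δ_{X̲→}` has
`τ(embK k₀) = a·gen` with `l ∤ a` (the zero set of the additive `τ` on `Π_{X_K}` is a subgroup; it cannot contain
`embK(I_{ε′} ⊔ jKer) = embK(Δ_X̲) ∋` a preimage of `gen ≠ 0`). ([IUTchI] Cor 1.2 p.39) [claim: Mochizuki2012, status: disputed] -/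
theorem exists_mem_jKer_tau_eq_smul_gen (hA : D.geom.pe.ArrowCoveringClaims)
    (hI : ∀ k ∈ D.geom.pe.inertia D.geom.pe.ε1, M.tau (D.geom.embK k) = 0) :
    ∃ k₀ ∈ D.geom.pe.jKer, ∃ a : ℤ, ¬ (l : ℤ) ∣ a ∧ M.tau (D.geom.embK k₀) = a • M.gen := by
  by_contra hcon
  push Not at hcon
  -- (1) then `τ` vanishes on `embK(jKer)`
  have hZj : ∀ k ∈ D.geom.pe.jKer, M.tau (D.geom.embK k) = 0 := by
    intro k hk
    have hkU : D.geom.embK k ∈ D.PiXund := map_jKer_le_PiXund hA ⟨k, hk, rfl⟩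
    obtain ⟨a, ha⟩ := (M.mem_PiXund_iff _ (D.PiXund_le_PiXK hkU)).mp hkU
    by_cases hla : (l : ℤ) ∣ a
    · rw [ha]; exact l1_zsmul_eq_zero_of_dvd E M.gen_torsion hla
    · exact absurd ha (hcon k hk a hla)
  -- (2) the zero set of `τ` on `Π_{X_K}` is a subgroup `Z`
  let Z : Subgroup D.PiC :=
    { carrier := {x | x ∈ D.PiXK ∧ M.tau x = 0}
      mul_mem' := by
        rintro x y ⟨hxK, hx⟩ ⟨hyK, hy⟩
        exact ⟨mul_mem hxK hyK, by rw [M.tau_mul_of_mem_PiXK hxK (PiXK_le_PiX hyK), hx, hy, add_zero]⟩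
      one_mem' := ⟨one_mem _, M.tau_one⟩
      inv_mem' := by
        rintro x ⟨hxK, hx⟩
        exact ⟨inv_mem hxK, by rw [M.tau_inv_of_mem_PiXK hxK, hx, neg_zero]⟩ }
  -- (3) `embK(Δ_X̲) = embK(I_{ε′} ⊔ jKer) ≤ Z`
  have hΔZ : D.geom.pe.DeltaXbar.map D.geom.embK ≤ Z := by
    rw [← hA.inertia_ε1_sup, Subgroup.map_sup]
    refine sup_le ?_ ?_
    · rintro _ ⟨k, hk, rfl⟩
      have hkU : D.geom.embK k ∈ D.PiXund :=
        ⟨k, (D.geom.pe.decomp_le D.geom.pe.ε1 hk.1), rfl⟩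
      exact ⟨D.PiXund_le_PiXK hkU, hI k hk⟩
    · rintro _ ⟨k, hk, rfl⟩
      exact ⟨D.PiXund_le_PiXK (map_jKer_le_PiXund hA ⟨k, hk, rfl⟩), hZj k hk⟩
  -- (4) a `τ`-preimage of `gen` in `Δ_X` lies in `embK(Δ_X̲)`, contradiction with `gen ≠ 0`
  obtain ⟨k, hkΔ, hk⟩ := M.tau_surjOn M.gen M.gen_torsion
  have hkK : k ∈ D.PiXK := ⟨hkΔ.1, DeltaC_le_PiCK D hkΔ.2⟩
  have hkU : k ∈ D.PiXund := (M.mem_PiXund_iff k hkK).mpr ⟨1, by rw [hk, one_zsmul]⟩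
  obtain ⟨y, hyX, hyk⟩ := hkU
  have hyΔ : y ∈ D.geom.pe.DeltaC := mem_pe_DeltaC_of_embK_mem_DeltaC D (hyk ▸ hkΔ.2)
  have hkZ : k ∈ Z := hΔZ ⟨y, ⟨hyX, hyΔ⟩, hyk⟩
  exact M.gen_ne_zero (hk ▸ hkZ.2)

include M in
/-- **(D) [IUTchI] Ex 6.3 (i) / Def 6.1 (iii) — the LOCAL ARROW LAW (L1), DERIVED**: for EVERY subgroup `H ⊇ embK(jKer)`
of `Π_{C_F}` (e.g. the local groups `Π_v̲`), an element `d` with `d⁻¹ H d ≤ Π_{X̲_K}` NORMALISES `Π_{X̲_K}` («morphisms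
`𝒟_v̲ → 𝒟^{⊚±}` are `Aut(𝒟^{⊚±})`-translates of `φ^{Θell}_{•,v̲}`»), from `M`, `hA` (only `I_{ε′} ⊔ jKer = Δ_X̲`) and the
named input `hI` («(rel)-type classical law: the cusp inertia of `X` dies in `Δ_X^{ab} ⊗ 𝔽_l = E[l]`», GAP G-L5d5g6-1), by
the Borel argument (A)–(C) — the field `LocalArrowLaw.mem_normalizer_of_conj_le` of abc-iut-L5-t4's interface law,
verbatim in its conclusion. ([IUTchI] Ex 6.3(i) p.161) [claim: Mochizuki2012, status: disputed] -/
theorem localArrowLaw_L1_of_torsionMonodromy (hA : D.geom.pe.ArrowCoveringClaims)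
    (hI : ∀ k ∈ D.geom.pe.inertia D.geom.pe.ε1, M.tau (D.geom.embK k) = 0)
    {H : Subgroup D.PiC} (hjH : D.geom.pe.jKer.map D.geom.embK ≤ H) :
    ∀ d : D.PiC, (∀ x ∈ H, d⁻¹ * x * d ∈ D.PiXund) →
      d ∈ Subgroup.normalizer ((D.PiXund : Subgroup D.PiC) : Set D.PiC) := by
  have hl : l.Prime := D.l_prime
  obtain ⟨k₀, hk₀, a, ha, hτ₀⟩ := M.exists_mem_jKer_tau_eq_smul_gen hA hI
  set x₀ : D.PiC := D.geom.embK k₀ with hx₀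
  have hx₀H : x₀ ∈ H := hjH ⟨k₀, hk₀, rfl⟩
  have hx₀K : x₀ ∈ D.PiXK := D.PiXund_le_PiXK (map_jKer_le_PiXund hA ⟨k₀, hk₀, rfl⟩)
  -- the case `g ∈ Π_{X_F}`
  have main : ∀ g : D.PiC, g ∈ D.geom.PiX → g⁻¹ * x₀ * g ∈ D.PiXund →
      g ∈ Subgroup.normalizer ((D.PiXund : Subgroup D.PiC) : Set D.PiC) := by
    intro g hg hgx
    have hg' : g⁻¹ ∈ D.geom.PiX := inv_mem hg
    have hconjK : g⁻¹ * x₀ * g⁻¹⁻¹ ∈ D.PiXK := (conj_mem_PiXK_iff hg' x₀).mpr hx₀K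
    have hgx' : g⁻¹ * x₀ * g⁻¹⁻¹ ∈ D.PiXund := by rwa [inv_inv]
    obtain ⟨b, hb⟩ := (M.mem_PiXund_iff _ hconjK).mp hgx'
    -- `σ_{g⁻¹}(a • gen) = b • gen`
    have hσ : galoisAct E (D.augGF g⁻¹) (a • M.gen) = b • M.gen := by
      rw [← hτ₀, ← M.tau_conj hg' hx₀K, hb]
    -- `l ∤ b` (else `a • gen = σ_g(σ_{g⁻¹}(a•gen)) = 0`, forcing `l ∣ a`)
    have hb' : ¬ (l : ℤ) ∣ b := by
      intro hlb
      have h0 : a • M.gen = 0 := by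
        have := congrArg (galoisAct E (D.augGF g⁻¹)⁻¹) hσ
        rw [l1_galoisAct_inv_apply, l1_zsmul_eq_zero_of_dvd E M.gen_torsion hlb, map_zero] at this
        exact this
      exact ha (l1_dvd_of_zsmul_eq_zero E hl M.gen_torsion M.gen_ne_zero h0)
    -- the inverse direction: `σ_g (b • gen) = a • gen`
    have hσ' : galoisAct E (D.augGF g) (b • M.gen) = a • M.gen := by
      have := congrArg (galoisAct E (D.augGF g⁻¹)⁻¹) hσ
      rw [l1_galoisAct_inv_apply, map_inv, inv_inv] at this
      exact this.symm
    exact M.mem_normalizer_PiXund_of_stabilizes_line hg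
      (l1_line_stable_of_apply_smul E hl (galoisAct E (D.augGF g)) M.gen_torsion hb' hσ')
      (l1_line_stable_of_apply_smul E hl (galoisAct E (D.augGF g⁻¹)) M.gen_torsion ha hσ)
  intro d hd
  by_cases hdX : d ∈ D.geom.PiX
  · exact main d hdX (hd x₀ hx₀H)
  · -- reduce to `Π_{X_F}` by the index-2 element of (B)
    obtain ⟨c, hcX, hcN⟩ := exists_not_mem_PiX_mem_normalizer_PiXund D
    have hdc : d * c ∈ D.geom.PiX := by
      rw [Subgroup.mul_mem_iff_of_index_two D.geom.PiX_index]
      exact ⟨fun h => absurd h hdX, fun h => absurd h hcX⟩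
    have hcN' : c⁻¹ ∈ Subgroup.normalizer ((D.PiXund : Subgroup D.PiC) : Set D.PiC) := inv_mem hcN
    have hconj : (d * c)⁻¹ * x₀ * (d * c) ∈ D.PiXund := by
      have h1 : d⁻¹ * x₀ * d ∈ D.PiXund := hd x₀ hx₀H
      have h2 := (Subgroup.mem_normalizer_iff.mp hcN' (d⁻¹ * x₀ * d)).mp h1
      have : (d * c)⁻¹ * x₀ * (d * c) = c⁻¹ * (d⁻¹ * x₀ * d) * c⁻¹⁻¹ := by group
      rwa [this]
    have hdcN := main (d * c) hdc hconj
    have : d = d * c * c⁻¹ := by group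
    rw [this]
    exact mul_mem hdcN hcN'

/-- `embK(jKer) ≤ Π_{X̲→_K} ∩ augGF⁻¹(G_v̲)` for EVERY subgroup `G_v̲ ≤ G_F`: `jKer ≤ Π_{X→}` by construction
(`piXarrow = decomp 2ε ⊔ jKer`) and `jKer ≤ Δ_X̲ ≤ Δ_{C_K}` lies over `1`. ([IUTchI] §1 p.38) [claim: Mochizuki2012, status: disputed] -/
theorem map_jKer_le_local (hA : D.geom.pe.ArrowCoveringClaims) (Gv : Subgroup (Fbar ≃ₐ[F] Fbar)) :
    D.geom.pe.jKer.map D.geom.embK ≤ D.PiXarrow ⊓ Gv.comap D.augGF := by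
  rintro _ ⟨k, hk, rfl⟩
  refine Subgroup.mem_inf.mpr ⟨⟨k, (le_sup_right : D.geom.pe.jKer ≤ D.geom.pe.piXarrow) hk, rfl⟩, ?_⟩
  rw [Subgroup.mem_comap]
  have hkΔ : k ∈ D.geom.pe.DeltaXbar := by
    rw [← hA.inertia_ε1_sup]; exact le_sup_right (α := Subgroup D.geom.pe.PiC) hk
  have hF : D.geom.embK k ∈ D.DeltaC := embK_mem_DeltaC_of_mem_pe_DeltaC D hkΔ.2
  have h1 : D.geom.extF.aug (D.geom.embK k) = 1 := hF
  have : D.augGF (D.geom.embK k) = 1 := by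
    change D.geom.galIso (D.geom.extF.aug (D.geom.embK k)) = 1
    rw [h1, map_one]
  rw [this]
  exact one_mem _

include M in
/-- **(L1) at the LOCAL GROUPS `Π_v̲ = Π_{X̲→_K} ∩ augGF⁻¹(G_v̲)`** (every subgroup `G_v̲ ≤ G_F`; at a good place `G_v̲` is a
decomposition group, Def 3.1 (e)(f) «`Π_v̲ := Π_{X̲→_v̲}`»): the field `mem_normalizer_of_conj_le` of
`D.LocalArrowLaw CG hS (D.PiXarrow ⊓ Gv.comap D.augGF)`, DERIVED from `{M, hA, hI}`. ([IUTchI] Ex 6.3(i) p.161) [claim: Mochizuki2012, status: disputed] -/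
theorem localArrowLaw_L1_local (hA : D.geom.pe.ArrowCoveringClaims)
    (hI : ∀ k ∈ D.geom.pe.inertia D.geom.pe.ε1, M.tau (D.geom.embK k) = 0)
    (Gv : Subgroup (Fbar ≃ₐ[F] Fbar)) :
    ∀ d : D.PiC, (∀ x ∈ D.PiXarrow ⊓ Gv.comap D.augGF, d⁻¹ * x * d ∈ D.PiXund) →
      d ∈ Subgroup.normalizer ((D.PiXund : Subgroup D.PiC) : Set D.PiC) :=
  M.localArrowLaw_L1_of_torsionMonodromy hA hI (map_jKer_le_local hA Gv)

end TorsionMonodromy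

end InitialThetaData

end Literature.IUT.HodgeTheaters

end
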